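import Summits.QuantumFields.YangMills.Theorems.FluctuationComparisonRegPrIntLOddsLedgerPregTop
import Summits.QuantumFields.YangMills.Theorems.FluctuationComparisonRegPrIntLOddsLedgerPregLow
import HarnessLib

/-!
# `FluctuationComparisonRegPrIntLOddsLedgerPregEnds` — THE PREG KNIT OF LINE g20-2 «ODDS LEDGER»: PREG WITH VERS's `(ν, ρ)` PREFIX HOLDS AT BOTH ENDS OF THE
# LEDGER, AT EVERY DEPTH ON THE FIRST RUNG, AND AT ALL DEPTHS MODULO INTERIOR WINDOW-REGULARITY ALONE
# (crux `UnitScaleTilt.FluctuationComparisonRegPrIntL`, stmt-QuantumFields-20520; organ LFR♯ᶜ; line file `Cruxes/…/Lines/odds_ledger.lean` v1.2)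

Cell `ym3-torus` (YM ladder rung R3 = continuum SU(2) Yang–Mills on T³ — a RUNG, NOT the Clay problem: not d = 4, not infinite volume, not a mass gap);
width seat `ym3-torus-px16` (gen 12); helper `--supports stmt-QuantumFields-20520`; ★★OWNER WORD 62 (e) «PREG′-on-the-first-rung = px16's knit over both
files» (✓p753251 `…OddsLedgerPregTop` of `ym3-torus-px21` g12: PREG-TOP + the DOOR; ✓p753239 `…OddsLedgerPregLow`: the `M = 0` end under `(ν, ρ)`).
THEOREMS ONLY (0 `def`, 0 `sorry`, default heartbeats) — a term-mode knit of NAMES; it proves nothing new.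

WHAT.  PREG `PartialWindowPositivityCan` of LINE g20-2 asks positivity on the window `W_J = {PlaqSmall θ_J}` of EVERY partial canonical density
`q_M = canonVersion (heightDensity^{histGoodBelow M})`; as lettered it is RULING №32 (α′)-class at the low depths (★★OWNER WORD 62 (a)).  With VERS's
`(ν, ρ)` prefix (the nested law and a continuous positive window version of `ν_{K,J}` — in scope where the line's composition calls PREG):
* ★`partialWindowPositivity_ends` — PREG′ at every depth `M` with `M = 0 ∨ K − J ≤ M`: `M = 0` is ✓`…PregLow.partialWindowPositivity_zero` (`q_0 = Z_K·ρ`),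
  `K − J ≤ M` is ✓`…PregTop.partialWindowPositivity_top` (WREG transfers across the window-fibre identity);
* ★★`partialWindowPositivity_depthOne` — on the FIRST RUNG `K = J + 1` (the runs of the line's `DepthOneOddsCan`) PREG′ holds at EVERY depth (`M = 0` or
  `M ≥ 1 = K − J`): the first rung of the odds ledger has NO regularity debt;
* ★★★`partialWindowPositivity_of_interiorRegSet` — PREG′ at ALL depths from ONE input: window-regularity of `heightDensity^{histGoodBelow M}` at the INTERIOR
  depths `0 < M < K − J` only (✓`…PregTop.partialWindowPositivityCan_of_lowRegSet`'s `hlow` with its `M = 0` instance DISCHARGED by `ρ` via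
  ✓`…PregLow.subset_regSet_heightDensity_univ_of_version`; the interior instances by ✓`…PregTop.heightDensityCan_pos_of_subset_of_regSet` + ✓WREG) — so the
  honest residual row «PWREG» (★★OWNER WORD 62 (c): large-field window-regularity through free intermediate depths, outside the WREG port's charted set,
  unlocated in print) is EXACTLY the interior depths, and is EMPTY on the first rung.

HONEST SCOPE.  A knit; PREG as LETTERED (no `(ν, ρ)`) is NOT proved; PWREG (the interior input), LEV (XL), LFR♯ᶜ, S2β, the crux 20520 and the rung
`YM3TorusSU2` are NOT proved; no summit statement is proved; the Yang–Mills mass gap is NOT proved.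
References: [Balaban1985UV3] (2) p. 256, (6)–(7) p. 257, (38)–(47) pp. 266–267; [Balaban1987RG1] (0.13) p. 254, (2.10) p. 267.
-/

noncomputable section

set_option autoImplicit false

open MeasureTheory Filter Topology Set
open scoped ENNReal NNReal
open Literature.MathematicalPhysics.QuantumFieldTheory.Balaban1983to89
open Literature.MathematicalPhysics.QuantumFieldTheory.Balaban1983to89.T3ContinuumYM3Torus
open Literature.MathematicalPhysics.QuantumFieldTheory.Balaban1983to89.T3NestedUnitLaws
open Literature.MathematicalPhysics.QuantumFieldTheory.Balaban1983to89.T3UnitLawDensityEML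
open Literature.MathematicalPhysics.QuantumFieldTheory.Balaban1983to89.T3UnitScaleTilt
open Literature.MathematicalPhysics.QuantumFieldTheory.Balaban1983to89.T3TiltDescent
open Literature.MathematicalPhysics.QuantumFieldTheory.Balaban1983to89.Missing
open scoped Literature.MathematicalPhysics.QuantumFieldTheory.Balaban1983to89.T3OrbitAverage
open Summit.QuantumFields.YangMills.Theorems.FluctuationComparisonRegPrIntLWregGlue (heightDensityCan)
open Summit.QuantumFields.YangMills.Theorems.FluctuationComparisonRegPrIntLWreg (windowRegularity)
open Summit.QuantumFields.YangMills.Theorems.FluctuationComparisonRegPrIntLOddsLedgerPregTop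
  (partialWindowPositivity_top heightDensityCan_pos_of_subset_of_regSet setOf_depthBelow_eq_histGood)
open Summit.QuantumFields.YangMills.Theorems.FluctuationComparisonRegPrIntLOddsLedgerPregLow
  (partialWindowPositivity_zero subset_regSet_heightDensity_univ_of_version)

namespace Summit.QuantumFields.YangMills.Theorems.FluctuationComparisonRegPrIntLOddsLedgerPregEnds

/-! ## §1 PREG′ at the two ends of the ledger -/

/-- ★ **PREG WITH VERS's `(ν, ρ)` PREFIX HOLDS AT THE TWO ENDS OF THE LEDGER** — the line's `PartialWindowPositivityCan` text with the nested law `ν` and a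
continuous positive window version `ρ` of `ν_{K,J}` added as hypotheses (VERS's ∕ LFR♯ᶜ's, in scope at the composition), restricted to the depths
`M = 0 ∨ K − J ≤ M`; conclusion = `0 < partialDensityCan F γ b₀ p₀ hJK M U` written out over ✓`…WregGlue.heightDensityCan` (`δ`-equal to the line's).
`M = 0`: ✓`…PregLow.partialWindowPositivity_zero`; `K − J ≤ M`: ✓`…PregTop.partialWindowPositivity_top` (thresholds `pS`, `γ₁` = PREG-TOP's = WREG's).
[cite: Balaban1985UV3, (2) p.256, (7) p.257 and (41) p.266; Balaban1987RG1, (2.10) p.267] -/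
theorem partialWindowPositivity_ends :
    ∀ (L : ℕ), ∃ pS : ℝ, ∀ (b₀ p₀ : ℝ), 0 < b₀ → pS ≤ p₀ → 0 < p₀ →
      ∃ γ₁ : ℝ, 0 < γ₁ ∧ ∀ (F : T3Family) (γ : ℝ), F.L = L → 0 < γ → γ ≤ γ₁ →
        ∀ (ν : ℕ → (j : ℕ) → Measure (GaugeField (F.P j) 0 (Matrix.specialUnitaryGroup (Fin 2) ℂ))),
          (∀ K, ν K K = T4GenFunBounds.gibbsMeasure (F.P K) ((F.scheme ℰp γ).β K)) →
          (∀ K j, j < K → ν K j = Measure.map (descend F ℰp j) (ν K (j + 1))) →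
          ∀ (J K : ℕ) (hJK : J ≤ K) (ρ : GaugeField (F.P J) 0 (Matrix.specialUnitaryGroup (Fin 2) ℂ) → ℝ),
            (∀ U, PlaqSmall (θBal F.L γ b₀ p₀ J) U → 0 < ρ U) →
            ν K J = (fieldMeasure _ _ _).withDensity (fun U => ENNReal.ofReal (ρ U)) →
            ContinuousOn ρ {U | PlaqSmall (θBal F.L γ b₀ p₀ J) U} →
            (∀ U : GaugeField (F.P J) 0 (Matrix.specialUnitaryGroup (Fin 2) ℂ), PlaqSmall (θBal F.L γ b₀ p₀ J) U →
                0 < heightDensityCan F γ hJK (histGood F ℰp (θBal F.L γ b₀ p₀) K J) U) →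
            ∀ (M : ℕ), (M = 0 ∨ K - J ≤ M) →
              ∀ (U : GaugeField (F.P J) 0 (Matrix.specialUnitaryGroup (Fin 2) ℂ)), PlaqSmall (θBal F.L γ b₀ p₀ J) U →
                0 < heightDensityCan F γ hJK {U' : GaugeField (F.P K) 0 (Matrix.specialUnitaryGroup (Fin 2) ℂ) | ∀ j, j + J ≤ K → j < M →
                  PlaqSmall (θBal F.L γ b₀ p₀ (K - j)) (Averaging.iter (fun i => BlockAveraging.blockAvg (P := F.P K) (j := i) ℰp) j U')} U := by
  intro L
  obtain ⟨pT, hT⟩ := partialWindowPositivity_top L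
  refine ⟨pT, fun b₀ p₀ hb hpT hp => ?_⟩
  obtain ⟨γT, hγT, hTF⟩ := hT b₀ p₀ hb hpT hp
  refine ⟨γT, hγT, fun F γ hL hγ hγle ν hKK hstep J K hJK ρ hρpos hν hρc hpos M hM U hU => ?_⟩
  rcases hM with hM0 | hMK
  · subst hM0
    exact partialWindowPositivity_zero F γ b₀ p₀ hγ ν hKK hstep J K hJK ρ hρpos hν hρc U hU
  · exact hTF F γ hL hγ hγle J K hJK hpos M U hU hMK

/-- ★★ **ON THE FIRST RUNG `K = J + 1` (the runs of the line's `DepthOneOddsCan`) PREG WITH VERS's PREFIX HOLDS AT EVERY DEPTH**: `M = 0` is the shallow end,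
every `M ≥ 1 = K − J` the deep end — the first rung of the odds ledger carries no window-regularity debt. [cite: Balaban1985UV3, (7) p.257 and (41) p.266] -/
theorem partialWindowPositivity_depthOne :
    ∀ (L : ℕ), ∃ pS : ℝ, ∀ (b₀ p₀ : ℝ), 0 < b₀ → pS ≤ p₀ → 0 < p₀ →
      ∃ γ₁ : ℝ, 0 < γ₁ ∧ ∀ (F : T3Family) (γ : ℝ), F.L = L → 0 < γ → γ ≤ γ₁ →
        ∀ (ν : ℕ → (j : ℕ) → Measure (GaugeField (F.P j) 0 (Matrix.specialUnitaryGroup (Fin 2) ℂ))),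
          (∀ K, ν K K = T4GenFunBounds.gibbsMeasure (F.P K) ((F.scheme ℰp γ).β K)) →
          (∀ K j, j < K → ν K j = Measure.map (descend F ℰp j) (ν K (j + 1))) →
          ∀ (J : ℕ) (ρ : GaugeField (F.P J) 0 (Matrix.specialUnitaryGroup (Fin 2) ℂ) → ℝ),
            (∀ U, PlaqSmall (θBal F.L γ b₀ p₀ J) U → 0 < ρ U) →
            ν (J + 1) J = (fieldMeasure _ _ _).withDensity (fun U => ENNReal.ofReal (ρ U)) →
            ContinuousOn ρ {U | PlaqSmall (θBal F.L γ b₀ p₀ J) U} →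
            (∀ U : GaugeField (F.P J) 0 (Matrix.specialUnitaryGroup (Fin 2) ℂ), PlaqSmall (θBal F.L γ b₀ p₀ J) U →
                0 < heightDensityCan F γ (Nat.le_succ J) (histGood F ℰp (θBal F.L γ b₀ p₀) (J + 1) J) U) →
            ∀ (M : ℕ) (U : GaugeField (F.P J) 0 (Matrix.specialUnitaryGroup (Fin 2) ℂ)), PlaqSmall (θBal F.L γ b₀ p₀ J) U →
              0 < heightDensityCan F γ (Nat.le_succ J) {U' : GaugeField (F.P (J + 1)) 0 (Matrix.specialUnitaryGroup (Fin 2) ℂ) |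
                ∀ j, j + J ≤ J + 1 → j < M →
                  PlaqSmall (θBal F.L γ b₀ p₀ (J + 1 - j)) (Averaging.iter (fun i => BlockAveraging.blockAvg (P := F.P (J + 1)) (j := i) ℰp) j U')} U := by
  intro L
  obtain ⟨pS, h⟩ := partialWindowPositivity_ends L
  refine ⟨pS, fun b₀ p₀ hb hpS hp => ?_⟩
  obtain ⟨γ₁, hγ₁, h⟩ := h b₀ p₀ hb hpS hp
  refine ⟨γ₁, hγ₁, fun F γ hL hγ hγle ν hKK hstep J ρ hρpos hν hρc hpos M U hU => ?_⟩
  have hM : M = 0 ∨ J + 1 - J ≤ M := by omega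
  exact h F γ hL hγ hγle ν hKK hstep J (J + 1) (Nat.le_succ J) ρ hρpos hν hρc hpos M hM U hU

/-! ## §2 PREG′ at all depths from INTERIOR window-regularity alone -/

/-- ★★★ **PREG WITH VERS's PREFIX AT ALL DEPTHS ⟸ INTERIOR WINDOW-REGULARITY** — ✓`…PregTop.partialWindowPositivityCan_of_lowRegSet` (PREG ⟸ window-regularity
at every depth `M < K − J`) with its `M = 0` instance DISCHARGED by the window version `ρ` (✓`…PregLow.subset_regSet_heightDensity_univ_of_version`): the only
input left is `hint`, regularity of `heightDensity^{histGoodBelow M}` on the window at the INTERIOR depths `0 < M < K − J` (free LARGE fields at the depths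
`M … K−J−1`, outside the charted set of ✓`exists_chartData_descendTo_reg`; [Balaban1985UV3] (38)–(47) territory, unlocated as a regularity statement) — the
row «PWREG» of ★★OWNER WORD 62 (c), empty when `K − J ≤ 1`. [cite: Balaban1985UV3, (7) p.257 and (38)-(47) p.266-267; Balaban1987RG1, (0.13) p.254 and (2.10) p.267] -/
theorem partialWindowPositivity_of_interiorRegSet
    (hint : ∀ (L : ℕ), ∃ pS : ℝ, ∀ (b₀ p₀ : ℝ), 0 < b₀ → pS ≤ p₀ → 0 < p₀ →
      ∃ γ₁ : ℝ, 0 < γ₁ ∧ ∀ (F : T3Family) (γ : ℝ), F.L = L → 0 < γ → γ ≤ γ₁ →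
        ∀ (J K : ℕ) (hJK : J ≤ K) (M : ℕ), 0 < M → M < K - J →
          {V : GaugeField (F.P J) 0 (Matrix.specialUnitaryGroup (Fin 2) ℂ) | PlaqSmall (θBal F.L γ b₀ p₀ J) V} ⊆
            Node00.regSet (fieldMeasure (F.P J) 0 (Matrix.specialUnitaryGroup (Fin 2) ℂ))
              (heightDensity F γ hJK
                {U' : GaugeField (F.P K) 0 (Matrix.specialUnitaryGroup (Fin 2) ℂ) | ∀ j, j + J ≤ K → j < M →
                  PlaqSmall (θBal F.L γ b₀ p₀ (K - j)) (Averaging.iter (fun i => BlockAveraging.blockAvg (P := F.P K) (j := i) ℰp) j U')})) :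
    ∀ (L : ℕ), ∃ pS : ℝ, ∀ (b₀ p₀ : ℝ), 0 < b₀ → pS ≤ p₀ → 0 < p₀ →
      ∃ γ₁ : ℝ, 0 < γ₁ ∧ ∀ (F : T3Family) (γ : ℝ), F.L = L → 0 < γ → γ ≤ γ₁ →
        ∀ (ν : ℕ → (j : ℕ) → Measure (GaugeField (F.P j) 0 (Matrix.specialUnitaryGroup (Fin 2) ℂ))),
          (∀ K, ν K K = T4GenFunBounds.gibbsMeasure (F.P K) ((F.scheme ℰp γ).β K)) →
          (∀ K j, j < K → ν K j = Measure.map (descend F ℰp j) (ν K (j + 1))) →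
          ∀ (J K : ℕ) (hJK : J ≤ K) (ρ : GaugeField (F.P J) 0 (Matrix.specialUnitaryGroup (Fin 2) ℂ) → ℝ),
            (∀ U, PlaqSmall (θBal F.L γ b₀ p₀ J) U → 0 < ρ U) →
            ν K J = (fieldMeasure _ _ _).withDensity (fun U => ENNReal.ofReal (ρ U)) →
            ContinuousOn ρ {U | PlaqSmall (θBal F.L γ b₀ p₀ J) U} →
            (∀ U : GaugeField (F.P J) 0 (Matrix.specialUnitaryGroup (Fin 2) ℂ), PlaqSmall (θBal F.L γ b₀ p₀ J) U →
                0 < heightDensityCan F γ hJK (histGood F ℰp (θBal F.L γ b₀ p₀) K J) U) →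
            ∀ (M : ℕ) (U : GaugeField (F.P J) 0 (Matrix.specialUnitaryGroup (Fin 2) ℂ)), PlaqSmall (θBal F.L γ b₀ p₀ J) U →
              0 < heightDensityCan F γ hJK {U' : GaugeField (F.P K) 0 (Matrix.specialUnitaryGroup (Fin 2) ℂ) | ∀ j, j + J ≤ K → j < M →
                PlaqSmall (θBal F.L γ b₀ p₀ (K - j)) (Averaging.iter (fun i => BlockAveraging.blockAvg (P := F.P K) (j := i) ℰp) j U')} U := by
  intro L
  obtain ⟨pI, hI⟩ := hint L
  obtain ⟨pE, hE⟩ := partialWindowPositivity_ends L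
  refine ⟨max pI pE, fun b₀ p₀ hb hp hp₀ => ?_⟩
  obtain ⟨γI, hγI, hIF⟩ := hI b₀ p₀ hb ((le_max_left _ _).trans hp) hp₀
  obtain ⟨γE, hγE, hEF⟩ := hE b₀ p₀ hb ((le_max_right _ _).trans hp) hp₀
  obtain ⟨γW, hγW, hWREG⟩ := windowRegularity L b₀ p₀ hb hp₀
  refine ⟨min (min γI γE) γW, lt_min (lt_min hγI hγE) hγW, fun F γ hL hγ hγle ν hKK hstep J K hJK ρ hρpos hν hρc hpos M U hU => ?_⟩
  have hγI' : γ ≤ γI := hγle.trans ((min_le_left _ _).trans (min_le_left _ _))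
  have hγE' : γ ≤ γE := hγle.trans ((min_le_left _ _).trans (min_le_right _ _))
  have hγW' : γ ≤ γW := hγle.trans (min_le_right _ _)
  by_cases hM : M = 0 ∨ K - J ≤ M
  · exact hEF F γ hL hγ hγE' ν hKK hstep J K hJK ρ hρpos hν hρc hpos M hM U hU
  · -- an interior depth: `0 < M < K − J`
    have hM0 : 0 < M := Nat.pos_of_ne_zero fun h => hM (Or.inl h)
    have hMlt : M < K - J := Nat.lt_of_not_le fun h => hM (Or.inr h)
    obtain ⟨hregW, hposW⟩ := hWREG F γ hL hγ hγW' J K hJK γ hγ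
    have hSsub : histGood F ℰp (θBal F.L γ b₀ p₀) K J ⊆
        {U' : GaugeField (F.P K) 0 (Matrix.specialUnitaryGroup (Fin 2) ℂ) | ∀ j, j + J ≤ K → j < M →
          PlaqSmall (θBal F.L γ b₀ p₀ (K - j)) (Averaging.iter (fun i => BlockAveraging.blockAvg (P := F.P K) (j := i) ℰp) j U')} :=
      fun U' hU' j hj _ => hU' j hj
    have hSm' : MeasurableSet
        {U' : GaugeField (F.P K) 0 (Matrix.specialUnitaryGroup (Fin 2) ℂ) | ∀ j, j + J ≤ K → j < M →
          PlaqSmall (θBal F.L γ b₀ p₀ (K - j)) (Averaging.iter (fun i => BlockAveraging.blockAvg (P := F.P K) (j := i) ℰp) j U')} := by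
      rw [setOf_depthBelow_eq_histGood F (θBal F.L γ b₀ p₀) hJK (by omega)]
      exact measurableSet_histGood F ℰp measurableE_ℰp _ K _
    exact heightDensityCan_pos_of_subset_of_regSet F hγ.le hJK (measurableSet_histGood F ℰp measurableE_ℰp _ K J) hSm' hSsub
      (Node00.isOpen_plaqSmall _) hregW (hIF F γ hL hγ hγI' J K hJK M hM0 hMlt) hU (hposW U hU)

end Summit.QuantumFields.YangMills.Theorems.FluctuationComparisonRegPrIntLOddsLedgerPregEnds

end
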